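import Literature.MathematicalPhysics.QuantumFieldTheory.Balaban1983to89.B8Prop6CubeMemberNormsAt
import Literature.MathematicalPhysics.QuantumFieldTheory.Balaban1983to89.Node00.CarriersB8Cube
import Literature.MathematicalPhysics.QuantumFieldTheory.Balaban1983to89.B8Prop6CubeMemberExists

/-!
# `Balaban1983to89.B8Prop6CubeMemberGauged` — [Balaban1985RegularSpaces] PROPOSITION 6 (p. 99) (1.135)–(1.138) AT THE CONCRETE CUBE
# MEMBER PACKAGED AS `Node00.GaugedBoundB8`, and `B8.Prop6Printed` ON THE MEMBER `Node00.zdCub` — modulo the knit's sockets AT THE CUBE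

statement-level skeleton of published theorems with citation tags; proofs where landed; nothing here is a claim about the
Yang–Mills mass gap

T. Bałaban, *Spaces of regular gauge field configurations on a lattice and gauge fixing conditions*, Commun. Math. Phys. **99**
(1985) 75–102 `[Balaban1985RegularSpaces]` ("B8"), Sect. F pp. 98–99, Proposition 6 (1.135)–(1.138).

CITATION HEADER (lean-in-tree rule).  Cell `pub-ymgap` (YM Track A, D-0062), DAG node N05 = [B8], seat `pub-ymgap-dag-n05-e` (R141 (C); FAN-OUT
v1.1 §N05 row s3b, module 3c).  WHY: the N05 knit `Node00.b8LeafOfRecord_of_knit` carries Proposition 6 as the printed member hypothesis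
`p6 : B8.Prop6Printed d L B₁ c₁ cub`; NODE 00's located member is `Node00.zdCub` (`Node00/CarriersB8Cube`) with `GaugedBound := Node00.GaugedBoundB8`
= (1.135)–(1.138) keyed verbatim to n05-c's Theorem-4-at-the-member letters (`B8Prop6CubeMember.prop6_exists_cubeMember_of_HFP₄` ∕
`B8Prop6CubeMemberExists…_of_HFP₃`), to the (1.136)₂–₄ letters (`B8Prop6CubeMemberNormsAt.norms136_cubeMember_printed`) and to (1.137)'s identity
(`B8Prop6CubeMemberEq137.eq137_cubeMember`).  THIS MODULE composes them by `Node00.gaugedBoundB8_intro` — MODULO, at each cube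
`c : Node00.CubeB8 d L K Ω`, the knit's Theorem-4 sockets (`SockHFP₀`∕`SockHFP` Prop. 5's fixed point, `SockH59` (1.59) [, `SockP5u` in the ₄ forms])
and the Prop.-3-frame b9 socket `SockB9P3`, all AT THE CUBE MEMBER.  Kind «kernel-checked proof», theorems only, no `def`.

WHAT THIS MODULE PROVES (kernel, 0 sorry).  §1 `gaugedBoundB8_cubeMember` — ONE threshold `c₁ > 0`; for `η > 0`, a cube `c` with the five sockets at
its member, a unitary `U₀ ∈ 𝔄_K({Ω_j}, α₀)`, «`7dL²·c.M·α₀ ≤ c₁`»: `GaugedBoundB8 L η U₀ c (7dL²(5dLB₀)·c.M·α₀)`.  §2 `prop6Printed_zdCub` —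
`B8.Prop6Printed d L (5dLB₀) c₁ (fun j => zdCub 𝔸 L (f j))` for every `f : ι → ZdIdx d L`.  §3 (v1.1) `gaugedBoundB8_of_clauses` (engine),
`gaugedBoundB8_cubeMember₃` ∕ `prop6Printed_zdCub₃` — THREE Theorem-4 EXISTENCE sockets (n05-c's `_of_HFP₃`; no `SockP5u`) + `SockB9P3`.  §4 (v1.2)
`prop6Printed_cubB8OfRecord₃` — the sentence on NODE 00's member of record `Node00.cubB8OfRecord θ` (the knit's `p6` letter at `ResidB8.withCub`).
§5 (v1.3) `ineq137_cubeB8` — (1.137)'s INEQUALITIES and `Ū₀″ᵏ = Ū₀′ᵏ` on `□^{(k)}` at every cube under «7dL²Mα₀ ≤ c₁», SOCKET-FREE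
(`B8Prop6OfThm4.ineq137_cube` BY NAME in `CubeB8` letters — the located complement of `GaugedBoundB8`'s identity clause).

HONEST SCOPE.  (i) `ℤᵈ` carriers, `𝔸 : Type` a nontrivial C⋆-algebra.  (ii) Sockets DISPLAYED per cube, not discharged.  (iii) Not folded into
`GaugedBoundB8`: uniqueness of `u`, (1.137)'s inequalities (§5; `eq137_cubeMember` conjuncts 2–4), the Hölder member (`norms136_cubeMember_printed`).
(iv) Norm form `≤` for print's `<`.  Count-neutral; N05 NOT discharged; nothing continuum ∕ ℝ⁴ ∕ OS ∕ mass-gap ∕ Clay.  Unit `pub-ymgap-dag-n05-e`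
(g0), 2026-08-26; v1.1–v1.3 same seat, APPEND-ONLY (earlier sections byte-identical).
-/

noncomputable section

open NormedSpace

namespace Literature.MathematicalPhysics.QuantumFieldTheory.Balaban1983to89.B8Prop6CubeMemberGauged

open MatrixLog B7Prop1Explicit B7Prop2Explicit B7Prop1Local B7Eq92Concrete
open B7Prop3Flat (c3)
open B8Ineq132 (InAk)
open B8Ineq133 (cutFixed)
open B8Eq115GaugeFixing (gaugeAct_mem_of)
open B8Eq140Level (SideTouches)
open B8Eq184Proof (cfgExp)
open B8Eq138LandauZd (logCfg)
open B8Eq131Cubes (tcube tLo tHi ctr)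
open B8Eq131CubesAdmissible (cubeFam)
open B8CubeMemberZd (cubeLamS cubeLamB)
open B8Prop6CubeMember (thm4_hypotheses_one_cutFixed prop6_exists_cubeMember_of_HFP₄)
open B8Prop6OfThm4 (const_136 smallness_134)
open B8LeafModelZd (SockH59 SockP5u ZdIdx)
open B8LeafModelZdOfHFP (SockHFP₀ SockHFP)
open B8LeafModelZd3 (mlogCfg mlogCfg_spec SockB9P3)
open B8Prop6CubeMemberEq137 (eq137_cubeMember)
open B8Prop6CubeMemberNormsAt (windows136_of_small norms136_cubeMember_printed)
open Node00 (CubeB8 GaugedBoundB8 gaugedBoundB8_intro zdCub prop6Printed_zdCub_iff)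

-- `Site` alone could resolve to the torus sites of `Setup.lean`; re-export the `ℤ^d` sites of `B7Prop1Explicit`.
export B7Prop1Explicit (Site)

variable {d : ℕ}

variable {𝔸 : Type} [CStarAlgebra 𝔸] [Nontrivial 𝔸]

/-! ## §1 (1.135)–(1.138) at every cube of the member, as `GaugedBoundB8` -/

/-- **PROPOSITION 6 (p. 99), (1.135)–(1.138) AS `Node00.GaugedBoundB8`, AT EVERY CUBE OF THE MEMBER, MODULO THE KNIT'S SOCKETS AT THE CUBE**:
«Let U₀, U₀′, □, □̃ be as described above, and let 7dL²Mα₀ ≤ c₁.  There exists a gauge transformation u defined on □̃ and such, that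
U₀^{u⁻¹} = U₁ = e^{iηA} on □̃, (1.135)  Lʲη|A|, (Lʲη)²|∇^ηA|, (Lʲη)³|∂^{η*}∂^ηA|, (Lʲη)³|Δ^ηA| < 7dL²B₁Mα₀ on □_j, (1.136)  Q_k(ηA) = (1∕i) log Ū₀′ᵏ on
□^{(k)} … (1.137)  R∂^{η*}A = 0 (1.138)».  ONE threshold `c₁ > 0` depending on `d, L` and the socket ∕ [4] constants only; `B₁ = 5dLB₀`.
[cite: Balaban1985RegularSpaces, Prop. 6 (1.135)–(1.138) p.99, p.98, Thm 4 p.88, Prop. 3 p.87] -/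
theorem gaugedBoundB8_cubeMember (hd2 : 2 ≤ d) {L : ℕ} (hL : 2 ≤ L) {B₀ B₀' B₀β C₂ cu cF₀ cF c59 cu' cB9 : ℝ} (hB₀ : 0 < B₀)
    (hB₀' : 0 < B₀') (hB : 2 ≤ 5 * (d : ℝ) * L * B₀) (hB₀β : 0 ≤ B₀β) (hC₂ : 2097152 * ((d : ℝ) + 1) ^ 2 ≤ C₂) (hcu : 0 < cu)
    (hcF₀ : 0 < cF₀) (hcF : 0 < cF) (hc59 : 0 < c59) (hcu' : 0 < cu') (hcB9 : 0 < cB9) (β : ℝ) (len : Site d → ℝ) :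
    ∃ c₁ : ℝ, 0 < c₁ ∧ ∀ (η : ℝ), 0 < η → ∀ {K : ℕ} {Ω : ℕ → Set (Site d)} (c : CubeB8 d L K Ω),
      SockHFP₀ (𝔸 := 𝔸) L B₀ B₀' cF₀ η c.k (cubeFam false L c.a c.M c.ρ c.k) (cubeLamS L c.a c.M c.ρ c.k) →
      SockHFP (𝔸 := 𝔸) L B₀ B₀' cF η c.k (cubeFam false L c.a c.M c.ρ c.k) (cubeLamS L c.a c.M c.ρ c.k) →
      SockH59 (𝔸 := 𝔸) L B₀ B₀' c59 η c.k (cubeFam false L c.a c.M c.ρ c.k) (cubeLamS L c.a c.M c.ρ c.k) (cubeLamB L c.a c.M c.ρ c.k) →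
      SockP5u (𝔸 := 𝔸) L cu' cu η c.k (cubeFam false L c.a c.M c.ρ c.k) (cubeLamS L c.a c.M c.ρ c.k) →
      SockB9P3 (𝔸 := 𝔸) L B₀ B₀β cB9 β len η c.k (cubeFam false L c.a c.M c.ρ c.k) (cubeLamS L c.a c.M c.ρ c.k) (cubeLamB L c.a c.M c.ρ c.k) →
      ∀ (U₀ : Site d → Fin d → 𝔸ˣ), (∀ x κ, U₀ x κ ∈ unitaryUnits 𝔸) → ∀ (α₀ : ℝ), 0 < α₀ → InAk L K η α₀ Ω U₀ →
      7 * d * (L : ℝ) ^ 2 * c.M * α₀ ≤ c₁ →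
      GaugedBoundB8 L η U₀ c (7 * d * (L : ℝ) ^ 2 * (5 * (d : ℝ) * L * B₀) * c.M * α₀) := by
  have hL1 : 1 ≤ L := le_trans (by norm_num) hL
  have hd1 : 1 ≤ d := le_trans (by norm_num) hd2
  have hLpos : (0 : ℝ) < L := by exact_mod_cast hL1
  have hdpos : (0 : ℝ) < d := by exact_mod_cast hd1
  have hC₂0 : 0 ≤ C₂ := le_trans (by positivity) hC₂
  obtain ⟨c₄, hc₄, H4⟩ := prop6_exists_cubeMember_of_HFP₄ (𝔸 := 𝔸) hd2 hL hB₀ hB₀' hB hcu hcF₀ hcF hc59 hcu'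
  obtain ⟨c₃, hc₃, H3⟩ := norms136_cubeMember_printed (𝔸 := 𝔸) hd2 hL hB₀ hB₀β hC₂ hcB9 β len
  obtain ⟨cW, hcW, W⟩ := windows136_of_small hd2 hL hB₀ hC₂0 one_pos
  set B : ℝ := 5 * (d : ℝ) * L * B₀ with hB_def
  have hB0 : 0 < B := by positivity
  set C : ℝ := 131072 * ((d : ℝ) + 1) ^ 2 with hC_def
  have hC1 : 1 ≤ C := by rw [hC_def]; nlinarith [sq_nonneg ((d : ℝ) + 1), hdpos]
  have hC0 : 0 < C := by positivity
  refine ⟨min c₄ (min c₃ (min cW (1 / (16 * C * B)))), lt_min hc₄ (lt_min hc₃ (lt_min hcW (by positivity))), ?_⟩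
  intro η hη K Ω c SHFP₀ SHFP SH59 SP5u SB9 U₀ hU₀ α₀ hα hAK hs
  -- the cube's laws as datum binders
  have hk : 1 ≤ c.k := c.one_le_k
  have hρL : L ≤ c.ρ := c.L_le_ρ
  have hρM : c.ρ ≤ c.M := c.ρ_le_M
  have hρ : 1 ≤ c.ρ := hL1.trans hρL
  have hM1 : 1 ≤ c.M := hρ.trans hρM
  have hM : 11 * (d : ℝ) < c.M := by exact_mod_cast c.big
  have hLdM : (L : ℝ) ≤ d * c.M := by exact_mod_cast c.L_le_dM
  have hA : InAk L c.k η α₀ Ω U₀ := c.inAk hAK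
  have hs₄ : 7 * d * (L : ℝ) ^ 2 * c.M * α₀ ≤ c₄ := hs.trans (min_le_left _ _)
  have hs₃ : 7 * d * (L : ℝ) ^ 2 * c.M * α₀ ≤ c₃ := hs.trans ((min_le_right _ _).trans (min_le_left _ _))
  have hsW : 7 * d * (L : ℝ) ^ 2 * c.M * α₀ ≤ cW := hs.trans ((min_le_right _ _).trans ((min_le_right _ _).trans (min_le_left _ _)))
  have hsC : 7 * d * (L : ℝ) ^ 2 * c.M * α₀ ≤ 1 / (16 * C * B) :=
    hs.trans ((min_le_right _ _).trans ((min_le_right _ _).trans (min_le_right _ _)))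
  -- the (1.130)-regime, `2α₂ ≤ c₃(d, L)`, `dMα₀ ≤ 1/2`
  obtain ⟨⟨hα3, hα2, hsmall⟩, -, -, ⟨-, -, -, -, hc3α, -⟩, h12⟩ := W c.M c.ρ hM1 hρM hM hLdM α₀ hα hsW
  -- THEOREM 4 at the member (n05-c), sharp (1.62) constant `α₂ = B₁(L³α₀ + 6dL²Mα₀)`
  obtain ⟨u, hu, huS, h129, hLan, h162, -, hw, h135⟩ := H4 η hη c.k hk c.a c.M c.ρ hρL hρM hM SHFP₀ SHFP SH59 SP5u U₀ hU₀ α₀ hα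
    hα3 hα2 Ω hA c.tcube_sub hsmall (smallness_134 hLpos hα hLdM hs₄)
  -- PROPOSITION 3 at the member (module 3b-ii): (1.136)₂–₄
  obtain ⟨-, h136₂, -, h136₃, h136₄⟩ := H3 η hη c.k hk c.a c.M c.ρ hρL hρM hM hLdM SB9 U₀ hU₀ α₀ hα Ω hA c.tcube_sub hs₃ u hu h129
    hLan h162
  -- [3] Prop. 4's window at `α₂` for the identity of (1.137)
  set α₂ : ℝ := B * ((L : ℝ) ^ 3 * α₀ + 6 * d * (L : ℝ) ^ 2 * c.M * α₀) with hα₂_def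
  have hα₂0 : 0 ≤ α₂ := by positivity
  have h16C : 16 * (131072 * ((d : ℝ) + 1) ^ 2) * α₂ ≤ 1 := by
    have e1 : α₂ ≤ 7 * d * (L : ℝ) ^ 2 * B * c.M * α₀ := const_136 hLpos hα hB0.le hLdM
    have e2 : 7 * d * (L : ℝ) ^ 2 * B * c.M * α₀ = B * (7 * d * (L : ℝ) ^ 2 * c.M * α₀) := by ring
    have e3 : B * (7 * d * (L : ℝ) ^ 2 * c.M * α₀) ≤ B * (1 / (16 * C * B)) := mul_le_mul_of_nonneg_left hsC hB0.le
    have e4 : B * (1 / (16 * C * B)) = 1 / (16 * C) := by field_simp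
    have e5 : α₂ ≤ 1 / (16 * C) := by linarith [e1, e3]
    calc 16 * (131072 * ((d : ℝ) + 1) ^ 2) * α₂ ≤ 16 * C * (1 / (16 * C)) := mul_le_mul_of_nonneg_left e5 (by positivity)
      _ = 1 := by field_simp
  have h16 : 16 * α₂ ≤ 1 := by
    have : 16 * α₂ ≤ 16 * C * α₂ := by nlinarith
    exact this.trans (by simpa only [hC_def] using h16C)
  -- the top-level representation clause for `A := mlogCfg …` from `mlogCfg_spec`
  set U'' := cutFixed L (tLo c.a c.ρ) (tHi c.a c.M c.ρ) U₀ c.k (ctr c.a c.M) with hU''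
  obtain ⟨hmem, -, -, -, -, -⟩ := thm4_hypotheses_one_cutFixed L hL hd1 c.k U₀ hU₀ hα hα3 hα2 c.a hρ hρM hM hη hA c.tcube_sub hsmall
  have hU₁u : ∀ x κ, gaugeAct u⁻¹ U'' x κ ∈ unitaryUnits 𝔸 := gaugeAct_mem_of hmem fun x => (unitaryUnits 𝔸).inv_mem (hu x)
  obtain ⟨-, hrep, -⟩ := mlogCfg_spec hη hL1 c.k (1 : Site d → Fin d → 𝔸ˣ) hU₁u hα₂0 h16 (cubeFam false L c.a c.M c.ρ c.k)
    (fun j hj y τ hsd => ⟨(h162 j hj (y, τ) hsd).1, (h162 j hj (y, τ) hsd).2.2⟩)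
  have h162k : ∀ (z : Site d) (ν : Fin d), SideTouches (cubeFam false L c.a c.M c.ρ c.k c.k) z ν →
      gaugeAct u⁻¹ U'' z ν = cfgExp η (mlogCfg c.k η (cubeFam false L c.a c.M c.ρ c.k) (gaugeAct u⁻¹ U'')) z ν ∧
        ‖mlogCfg c.k η (cubeFam false L c.a c.M c.ρ c.k) (gaugeAct u⁻¹ U'') z ν‖ ≤ α₂ * ((L : ℝ) ^ c.k * η)⁻¹ := fun z ν hsd =>
    ⟨(hrep c.k le_rfl z ν hsd).2, by rw [(hrep c.k le_rfl z ν hsd).1]; exact (h162 c.k le_rfl (z, ν) hsd).2.2⟩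
  -- (1.137)'s identity (module 3a)
  have h137 : ∀ (x : Site d) (μ : Fin d), B8Eq131Cubes.bLo L c.a 0 0 ≤ x → x + e μ ≤ B8Eq131Cubes.bHi L c.a c.M 0 0 →
      B7Prop4GeneralLevels.logCovIter L (1 : Site d → Fin d → 𝔸ˣ)
          (B8Eq146AExpansion.iEta η (mlogCfg c.k η (cubeFam false L c.a c.M c.ρ c.k) (gaugeAct u⁻¹ U''))) c.k x μ =
        mlog ((avgIter L (gaugeAct (B8Eq115GaugeFixing.localGauge L (tLo c.a c.ρ) (tHi c.a c.M c.ρ) U₀ c.k (ctr c.a c.M)) U₀) c.k x μ :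
          𝔸ˣ) : 𝔸) := fun x μ hx hx' =>
    (eq137_cubeMember hd2 hL hk U₀ hU₀ hα hα3 hα2 c.a hρ hρM hM hη hA c.tcube_sub c.box_sub hsmall h12 u h129 _ hα₂0 h16C hc3α h162k x μ
      hx hx').1
  -- the (1.62)-shape with print's constant `7dL²B₁Mα₀`
  have h162' : ∀ j, j ≤ c.k → ∀ b ∈ {b : Site d × Fin d | SideTouches (cubeFam false L c.a c.M c.ρ c.k j) b.1 b.2},
      gaugeAct u⁻¹ U'' b.1 b.2 = cfgExp η (logCfg η (gaugeAct u⁻¹ U'')) b.1 b.2 ∧ IsSelfAdjoint (logCfg η (gaugeAct u⁻¹ U'') b.1 b.2) ∧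
        ‖logCfg η (gaugeAct u⁻¹ U'') b.1 b.2‖ ≤ (7 * d * (L : ℝ) ^ 2 * (5 * (d : ℝ) * L * B₀) * c.M * α₀) * ((L : ℝ) ^ j * η)⁻¹ := by
    intro j hj b hb
    obtain ⟨h1, h2, h3⟩ := h162 j hj b hb
    refine ⟨h1, h2, h3.trans ?_⟩
    have hη0 : 0 ≤ ((L : ℝ) ^ j * η)⁻¹ := by positivity
    exact mul_le_mul_of_nonneg_right (const_136 hLpos hα hB0.le hLdM) hη0
  exact gaugedBoundB8_intro L η U₀ c _ u hu huS h129 hLan h162' hw h135 h136₂ h136₃ h136₄ h137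

/-! ## §2 `B8.Prop6Printed` on the member `zdCub` -/

/-- **`B8.Prop6Printed d L B₁ c₁` ON NODE 00's MEMBER `zdCub`** (the printed Proposition 6 as the knit reads it, `p6`), for every family
`f : ι → ZdIdx d L` of ambient data, `B₁ = 5dLB₀` and the threshold of `gaugedBoundB8_cubeMember` — MODULO the five sockets at every cube of
every member (`prop6Printed_zdCub_iff`; the ambient `𝔄_{K}` truncates to `𝔄_k` by `CubeB8.inAk`). [cite: Balaban1985RegularSpaces, Prop. 6 p.99] -/
theorem prop6Printed_zdCub (hd2 : 2 ≤ d) {L : ℕ} (hL : 2 ≤ L) {B₀ B₀' B₀β C₂ cu cF₀ cF c59 cu' cB9 : ℝ} (hB₀ : 0 < B₀)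
    (hB₀' : 0 < B₀') (hB : 2 ≤ 5 * (d : ℝ) * L * B₀) (hB₀β : 0 ≤ B₀β) (hC₂ : 2097152 * ((d : ℝ) + 1) ^ 2 ≤ C₂) (hcu : 0 < cu)
    (hcF₀ : 0 < cF₀) (hcF : 0 < cF) (hc59 : 0 < c59) (hcu' : 0 < cu') (hcB9 : 0 < cB9) (β : ℝ) (len : Site d → ℝ) :
    ∃ c₁ : ℝ, 0 < c₁ ∧ ∀ {ι : Type} (f : ι → ZdIdx d L),
      (∀ (j : ι) (c : CubeB8 d L (f j).k (f j).Ω),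
        SockHFP₀ (𝔸 := 𝔸) L B₀ B₀' cF₀ (f j).η c.k (cubeFam false L c.a c.M c.ρ c.k) (cubeLamS L c.a c.M c.ρ c.k) ∧
        SockHFP (𝔸 := 𝔸) L B₀ B₀' cF (f j).η c.k (cubeFam false L c.a c.M c.ρ c.k) (cubeLamS L c.a c.M c.ρ c.k) ∧
        SockH59 (𝔸 := 𝔸) L B₀ B₀' c59 (f j).η c.k (cubeFam false L c.a c.M c.ρ c.k) (cubeLamS L c.a c.M c.ρ c.k) (cubeLamB L c.a c.M c.ρ c.k) ∧
        SockP5u (𝔸 := 𝔸) L cu' cu (f j).η c.k (cubeFam false L c.a c.M c.ρ c.k) (cubeLamS L c.a c.M c.ρ c.k) ∧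
        SockB9P3 (𝔸 := 𝔸) L B₀ B₀β cB9 β len (f j).η c.k (cubeFam false L c.a c.M c.ρ c.k) (cubeLamS L c.a c.M c.ρ c.k)
          (cubeLamB L c.a c.M c.ρ c.k)) →
      B8.Prop6Printed d (L : ℝ) (5 * (d : ℝ) * L * B₀) c₁ (fun j => zdCub 𝔸 L (f j)) := by
  obtain ⟨c₁, hc₁, G⟩ := gaugedBoundB8_cubeMember (𝔸 := 𝔸) hd2 hL hB₀ hB₀' hB hB₀β hC₂ hcu hcF₀ hcF hc59 hcu' hcB9 β len
  refine ⟨c₁, hc₁, fun f S => ?_⟩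
  rw [prop6Printed_zdCub_iff]
  intro j α₀ hα U₀ hInA c hs
  obtain ⟨S₁, S₂, S₃, S₄, S₅⟩ := S j c
  exact G (f j).η (f j).hη c S₁ S₂ S₃ S₄ S₅ U₀.1 U₀.2 α₀ hα hInA hs

/-! ## §3 (v1.1) The three-socket forms: Theorem 4's existence half only -/

/-- **(1.135)–(1.138) AS `GaugedBoundB8` AT EVERY CUBE, FROM A GAUGE TRANSFORMATION WITH THEOREM 4's CLAUSES** (bookkeeping engine of this
module): given the datum of a cube `c` in the (1.130)-regime with `dMα₀ ≤ 1∕2`, [3] Prop. 4's window `16·131072(d+1)²·α₂ ≤ 1`, `2α₂ ≤ c₃(d, L)` at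
`α₂ = 5dLB₀(L³α₀ + 6dL²Mα₀)`, a unitary `u` (= 1 off `□₀`) with (1.29), (1.38) of record, the sharp (1.62)-shape, `w = v⁻¹u` unitary and (1.135),
and the three norm members with print's constant: `GaugedBoundB8 L η U₀ c (7dL²(5dLB₀)Mα₀)` — (1.137)'s identity by `eq137_cubeMember` at
`A := mlogCfg …` (`mlogCfg_spec`), the (1.62) constant weakened by `const_136`, assembled by `gaugedBoundB8_intro`.
[cite: Balaban1985RegularSpaces, Prop. 6 (1.135)–(1.138) p.99, (1.137) p.99, (1.134) p.99] -/
theorem gaugedBoundB8_of_clauses (hd2 : 2 ≤ d) {L : ℕ} (hL : 2 ≤ L) {B₀ : ℝ} (hB₀ : 0 < B₀) {η : ℝ} (hη : 0 < η) {K : ℕ}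
    {Ω : ℕ → Set (Site d)} (c : CubeB8 d L K Ω) (U₀ : Site d → Fin d → 𝔸ˣ) (hU₀ : ∀ x κ, U₀ x κ ∈ unitaryUnits 𝔸) {α₀ : ℝ} (hα : 0 < α₀)
    (hA : InAk L c.k η α₀ Ω U₀) (hα3 : C0 d * (α₀ * (L : ℝ) ^ 2) ≤ 1 / 3) (hα2 : 2 * (α₀ * (L : ℝ) ^ 2) ≤ c2' d L)
    (hsmall : 11 * (d : ℝ) ^ 2 * (L : ℝ) ^ 2 * α₀ + ((c.M : ℝ) + 4 * c.ρ) * d * (L : ℝ) ^ 2 * α₀ ≤ 1 / 6) (h12 : (d : ℝ) * c.M * α₀ ≤ 1 / 2)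
    (h16C : 16 * (131072 * ((d : ℝ) + 1) ^ 2) * (5 * (d : ℝ) * L * B₀ * ((L : ℝ) ^ 3 * α₀ + 6 * d * (L : ℝ) ^ 2 * c.M * α₀)) ≤ 1)
    (hc3α : 2 * (5 * (d : ℝ) * L * B₀ * ((L : ℝ) ^ 3 * α₀ + 6 * d * (L : ℝ) ^ 2 * c.M * α₀)) ≤ c3 d L)
    (u : Site d → 𝔸ˣ) (hu : ∀ x, u x ∈ unitaryUnits 𝔸) (huS : ∀ x, x ∉ cubeFam false L c.a c.M c.ρ c.k 0 → u x = 1)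
    (h129 : B8Eq119TwistedAxial.Restr129 L c.k (cubeLamS L c.a c.M c.ρ c.k c.k) (1 : Site d → Fin d → 𝔸ˣ) u)
    (hLan : B8Eq138LandauZd.IsLandau138W L c.k η (cubeFam false L c.a c.M c.ρ c.k 0) (cubeLamS L c.a c.M c.ρ c.k c.k) (1 : Site d → Fin d → 𝔸ˣ)
      (gaugeAct u⁻¹ (cutFixed L (tLo c.a c.ρ) (tHi c.a c.M c.ρ) U₀ c.k (ctr c.a c.M))))
    (h162 : ∀ j, j ≤ c.k → ∀ b ∈ {b : Site d × Fin d | SideTouches (cubeFam false L c.a c.M c.ρ c.k j) b.1 b.2},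
      gaugeAct u⁻¹ (cutFixed L (tLo c.a c.ρ) (tHi c.a c.M c.ρ) U₀ c.k (ctr c.a c.M)) b.1 b.2 =
          cfgExp η (logCfg η (gaugeAct u⁻¹ (cutFixed L (tLo c.a c.ρ) (tHi c.a c.M c.ρ) U₀ c.k (ctr c.a c.M)))) b.1 b.2 ∧
        IsSelfAdjoint (logCfg η (gaugeAct u⁻¹ (cutFixed L (tLo c.a c.ρ) (tHi c.a c.M c.ρ) U₀ c.k (ctr c.a c.M))) b.1 b.2) ∧
        ‖logCfg η (gaugeAct u⁻¹ (cutFixed L (tLo c.a c.ρ) (tHi c.a c.M c.ρ) U₀ c.k (ctr c.a c.M))) b.1 b.2‖ ≤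
          (5 * (d : ℝ) * L * B₀ * ((L : ℝ) ^ 3 * α₀ + 6 * d * (L : ℝ) ^ 2 * c.M * α₀)) * ((L : ℝ) ^ j * η)⁻¹)
    (hw : ∀ x, ((B8Eq115GaugeFixing.localGauge L (tLo c.a c.ρ) (tHi c.a c.M c.ρ) U₀ c.k (ctr c.a c.M))⁻¹ * u) x ∈ unitaryUnits 𝔸)
    (h135 : AgreeOn (B8Ineq130.tlo L (tLo c.a c.ρ) c.k) (B8Ineq130.thi L (tHi c.a c.M c.ρ) c.k)
      (gaugeAct ((B8Eq115GaugeFixing.localGauge L (tLo c.a c.ρ) (tHi c.a c.M c.ρ) U₀ c.k (ctr c.a c.M))⁻¹ * u)⁻¹ U₀)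
      (gaugeAct u⁻¹ (cutFixed L (tLo c.a c.ρ) (tHi c.a c.M c.ρ) U₀ c.k (ctr c.a c.M))))
    (h136₂ : B8ScaledSupNorm.msup L c.k η (-(2 : ℝ)) (fun j (t : Fin d × Fin d × Site d) => SideTouches (cubeFam false L c.a c.M c.ρ c.k j) t.2.2 t.2.1)
      (fun t => B8Ineq132.covDerivFwd η (1 : Site d → Fin d → 𝔸ˣ) t.1
        (fun z => mlogCfg c.k η (cubeFam false L c.a c.M c.ρ c.k) (gaugeAct u⁻¹ (cutFixed L (tLo c.a c.ρ) (tHi c.a c.M c.ρ) U₀ c.k (ctr c.a c.M))) z t.2.1)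
        t.2.2) ≤ 7 * d * (L : ℝ) ^ 2 * (5 * (d : ℝ) * L * B₀) * c.M * α₀)
    (h136₃ : B8ScaledSupNorm.bondNorm L c.k η (-(3 : ℝ)) (cubeFam false L c.a c.M c.ρ c.k)
      (fun x μ => B8Eq143PlaqExpansion.pdiv η (1 : Site d → Fin d → 𝔸ˣ) (B8Eq146AExpansion.plaqCovDeriv η (1 : Site d → Fin d → 𝔸ˣ)
        (mlogCfg c.k η (cubeFam false L c.a c.M c.ρ c.k) (gaugeAct u⁻¹ (cutFixed L (tLo c.a c.ρ) (tHi c.a c.M c.ρ) U₀ c.k (ctr c.a c.M))))) μ x)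
        ≤ 7 * d * (L : ℝ) ^ 2 * (5 * (d : ℝ) * L * B₀) * c.M * α₀)
    (h136₄ : B8ScaledSupNorm.bondNorm L c.k η (-(3 : ℝ)) (cubeFam false L c.a c.M c.ρ c.k)
      (fun x μ => B8Eq138LandauZd.covLap η (1 : Site d → Fin d → 𝔸ˣ)
        (fun z => mlogCfg c.k η (cubeFam false L c.a c.M c.ρ c.k) (gaugeAct u⁻¹ (cutFixed L (tLo c.a c.ρ) (tHi c.a c.M c.ρ) U₀ c.k (ctr c.a c.M))) z μ) x)
        ≤ 7 * d * (L : ℝ) ^ 2 * (5 * (d : ℝ) * L * B₀) * c.M * α₀) :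
    GaugedBoundB8 L η U₀ c (7 * d * (L : ℝ) ^ 2 * (5 * (d : ℝ) * L * B₀) * c.M * α₀) := by
  have hL1 : 1 ≤ L := le_trans (by norm_num) hL
  have hd1 : 1 ≤ d := le_trans (by norm_num) hd2
  have hLpos : (0 : ℝ) < L := by exact_mod_cast hL1
  have hdpos : (0 : ℝ) < d := by exact_mod_cast hd1
  have hk : 1 ≤ c.k := c.one_le_k
  have hρ : 1 ≤ c.ρ := hL1.trans c.L_le_ρ
  have hM1 : 1 ≤ c.M := hρ.trans c.ρ_le_M
  have hMpos : (0 : ℝ) < c.M := by exact_mod_cast hM1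
  have hM : 11 * (d : ℝ) < c.M := by exact_mod_cast c.big
  have hLdM : (L : ℝ) ≤ d * c.M := by exact_mod_cast c.L_le_dM
  have hB0 : 0 < 5 * (d : ℝ) * L * B₀ := by positivity
  set α₂ : ℝ := 5 * (d : ℝ) * L * B₀ * ((L : ℝ) ^ 3 * α₀ + 6 * d * (L : ℝ) ^ 2 * c.M * α₀) with hα₂_def
  have hα₂0 : 0 ≤ α₂ := by positivity
  have h16 : 16 * α₂ ≤ 1 := by
    have hC1 : (1 : ℝ) ≤ 131072 * ((d : ℝ) + 1) ^ 2 := by nlinarith [sq_nonneg ((d : ℝ) + 1), hdpos]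
    have : 16 * α₂ ≤ 16 * (131072 * ((d : ℝ) + 1) ^ 2) * α₂ := by nlinarith
    exact this.trans h16C
  set U'' := cutFixed L (tLo c.a c.ρ) (tHi c.a c.M c.ρ) U₀ c.k (ctr c.a c.M) with hU''
  obtain ⟨hmem, -, -, -, -, -⟩ :=
    thm4_hypotheses_one_cutFixed L hL hd1 c.k U₀ hU₀ hα hα3 hα2 c.a hρ c.ρ_le_M hM hη hA c.tcube_sub hsmall
  have hU₁u : ∀ x κ, gaugeAct u⁻¹ U'' x κ ∈ unitaryUnits 𝔸 := gaugeAct_mem_of hmem fun x => (unitaryUnits 𝔸).inv_mem (hu x)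
  obtain ⟨-, hrep, -⟩ := mlogCfg_spec hη hL1 c.k (1 : Site d → Fin d → 𝔸ˣ) hU₁u hα₂0 h16 (cubeFam false L c.a c.M c.ρ c.k)
    (fun j hj y τ hsd => ⟨(h162 j hj (y, τ) hsd).1, (h162 j hj (y, τ) hsd).2.2⟩)
  have h162k : ∀ (z : Site d) (ν : Fin d), SideTouches (cubeFam false L c.a c.M c.ρ c.k c.k) z ν →
      gaugeAct u⁻¹ U'' z ν = cfgExp η (mlogCfg c.k η (cubeFam false L c.a c.M c.ρ c.k) (gaugeAct u⁻¹ U'')) z ν ∧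
        ‖mlogCfg c.k η (cubeFam false L c.a c.M c.ρ c.k) (gaugeAct u⁻¹ U'') z ν‖ ≤ α₂ * ((L : ℝ) ^ c.k * η)⁻¹ := fun z ν hsd =>
    ⟨(hrep c.k le_rfl z ν hsd).2, by rw [(hrep c.k le_rfl z ν hsd).1]; exact (h162 c.k le_rfl (z, ν) hsd).2.2⟩
  have h137 : ∀ (x : Site d) (μ : Fin d), B8Eq131Cubes.bLo L c.a 0 0 ≤ x → x + e μ ≤ B8Eq131Cubes.bHi L c.a c.M 0 0 →
      B7Prop4GeneralLevels.logCovIter L (1 : Site d → Fin d → 𝔸ˣ)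
          (B8Eq146AExpansion.iEta η (mlogCfg c.k η (cubeFam false L c.a c.M c.ρ c.k) (gaugeAct u⁻¹ U''))) c.k x μ =
        mlog ((avgIter L (gaugeAct (B8Eq115GaugeFixing.localGauge L (tLo c.a c.ρ) (tHi c.a c.M c.ρ) U₀ c.k (ctr c.a c.M)) U₀) c.k x μ :
          𝔸ˣ) : 𝔸) := fun x μ hx hx' =>
    (eq137_cubeMember hd2 hL hk U₀ hU₀ hα hα3 hα2 c.a hρ c.ρ_le_M hM hη hA c.tcube_sub c.box_sub hsmall h12 u h129 _ hα₂0 h16C hc3α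
      h162k x μ hx hx').1
  have h162' : ∀ j, j ≤ c.k → ∀ b ∈ {b : Site d × Fin d | SideTouches (cubeFam false L c.a c.M c.ρ c.k j) b.1 b.2},
      gaugeAct u⁻¹ U'' b.1 b.2 = cfgExp η (logCfg η (gaugeAct u⁻¹ U'')) b.1 b.2 ∧ IsSelfAdjoint (logCfg η (gaugeAct u⁻¹ U'') b.1 b.2) ∧
        ‖logCfg η (gaugeAct u⁻¹ U'') b.1 b.2‖ ≤ (7 * d * (L : ℝ) ^ 2 * (5 * (d : ℝ) * L * B₀) * c.M * α₀) * ((L : ℝ) ^ j * η)⁻¹ := by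
    intro j hj b hb
    obtain ⟨h1, h2, h3⟩ := h162 j hj b hb
    refine ⟨h1, h2, h3.trans ?_⟩
    have hη0 : 0 ≤ ((L : ℝ) ^ j * η)⁻¹ := by positivity
    exact mul_le_mul_of_nonneg_right (const_136 hLpos hα hB0.le hLdM) hη0
  exact gaugedBoundB8_intro L η U₀ c _ u hu huS h129 hLan h162' hw h135 h136₂ h136₃ h136₄ h137

/-- **PROPOSITION 6 (p. 99), (1.135)–(1.138) AS `GaugedBoundB8` AT EVERY CUBE, THREE THEOREM-4 SOCKETS** (the EXISTENCE half of Theorem 4 —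
Proposition 5's fixed point base ∕ step `SockHFP₀`∕`SockHFP` and (1.59) `SockH59` — plus the Prop.-3-frame b9 socket `SockB9P3`, all AT THE CUBE
MEMBER; no uniqueness socket): `gaugedBoundB8_cubeMember` with n05-c's `B8Prop6CubeMemberExists.prop6_exists_cubeMember_of_HFP₃` for Theorem 4.
[cite: Balaban1985RegularSpaces, Prop. 6 (1.135)–(1.138) p.99, Thm 4 p.88 (existence), Prop. 3 p.87] -/
theorem gaugedBoundB8_cubeMember₃ (hd2 : 2 ≤ d) {L : ℕ} (hL : 2 ≤ L) {B₀ B₀' B₀β C₂ cF₀ cF c59 cB9 : ℝ} (hB₀ : 0 < B₀)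
    (hB₀' : 0 < B₀') (hB : 2 ≤ 5 * (d : ℝ) * L * B₀) (hB₀β : 0 ≤ B₀β) (hC₂ : 2097152 * ((d : ℝ) + 1) ^ 2 ≤ C₂)
    (hcF₀ : 0 < cF₀) (hcF : 0 < cF) (hc59 : 0 < c59) (hcB9 : 0 < cB9) (β : ℝ) (len : Site d → ℝ) :
    ∃ c₁ : ℝ, 0 < c₁ ∧ ∀ (η : ℝ), 0 < η → ∀ {K : ℕ} {Ω : ℕ → Set (Site d)} (c : CubeB8 d L K Ω),
      SockHFP₀ (𝔸 := 𝔸) L B₀ B₀' cF₀ η c.k (cubeFam false L c.a c.M c.ρ c.k) (cubeLamS L c.a c.M c.ρ c.k) →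
      SockHFP (𝔸 := 𝔸) L B₀ B₀' cF η c.k (cubeFam false L c.a c.M c.ρ c.k) (cubeLamS L c.a c.M c.ρ c.k) →
      SockH59 (𝔸 := 𝔸) L B₀ B₀' c59 η c.k (cubeFam false L c.a c.M c.ρ c.k) (cubeLamS L c.a c.M c.ρ c.k) (cubeLamB L c.a c.M c.ρ c.k) →
      SockB9P3 (𝔸 := 𝔸) L B₀ B₀β cB9 β len η c.k (cubeFam false L c.a c.M c.ρ c.k) (cubeLamS L c.a c.M c.ρ c.k) (cubeLamB L c.a c.M c.ρ c.k) →
      ∀ (U₀ : Site d → Fin d → 𝔸ˣ), (∀ x κ, U₀ x κ ∈ unitaryUnits 𝔸) → ∀ (α₀ : ℝ), 0 < α₀ → InAk L K η α₀ Ω U₀ →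
      7 * d * (L : ℝ) ^ 2 * c.M * α₀ ≤ c₁ →
      GaugedBoundB8 L η U₀ c (7 * d * (L : ℝ) ^ 2 * (5 * (d : ℝ) * L * B₀) * c.M * α₀) := by
  have hL1 : 1 ≤ L := le_trans (by norm_num) hL
  have hd1 : 1 ≤ d := le_trans (by norm_num) hd2
  have hLpos : (0 : ℝ) < L := by exact_mod_cast hL1
  have hdpos : (0 : ℝ) < d := by exact_mod_cast hd1
  have hC₂0 : 0 ≤ C₂ := le_trans (by positivity) hC₂
  obtain ⟨c₄, hc₄, H4⟩ := B8Prop6CubeMemberExists.prop6_exists_cubeMember_of_HFP₃ (𝔸 := 𝔸) hd2 hL hB₀ hB₀' hB hcF₀ hcF hc59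
  obtain ⟨c₃, hc₃, H3⟩ := norms136_cubeMember_printed (𝔸 := 𝔸) hd2 hL hB₀ hB₀β hC₂ hcB9 β len
  obtain ⟨cW, hcW, W⟩ := windows136_of_small hd2 hL hB₀ hC₂0 one_pos
  set B : ℝ := 5 * (d : ℝ) * L * B₀ with hB_def
  have hB0 : 0 < B := by positivity
  set C : ℝ := 131072 * ((d : ℝ) + 1) ^ 2 with hC_def
  have hC0 : 0 < C := by positivity
  refine ⟨min c₄ (min c₃ (min cW (1 / (16 * C * B)))), lt_min hc₄ (lt_min hc₃ (lt_min hcW (by positivity))), ?_⟩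
  intro η hη K Ω c SHFP₀ SHFP SH59 SB9 U₀ hU₀ α₀ hα hAK hs
  have hk : 1 ≤ c.k := c.one_le_k
  have hρ : 1 ≤ c.ρ := hL1.trans c.L_le_ρ
  have hM1 : 1 ≤ c.M := hρ.trans c.ρ_le_M
  have hM : 11 * (d : ℝ) < c.M := by exact_mod_cast c.big
  have hLdM : (L : ℝ) ≤ d * c.M := by exact_mod_cast c.L_le_dM
  have hA : InAk L c.k η α₀ Ω U₀ := c.inAk hAK
  have hs₄ : 7 * d * (L : ℝ) ^ 2 * c.M * α₀ ≤ c₄ := hs.trans (min_le_left _ _)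
  have hs₃ : 7 * d * (L : ℝ) ^ 2 * c.M * α₀ ≤ c₃ := hs.trans ((min_le_right _ _).trans (min_le_left _ _))
  have hsW : 7 * d * (L : ℝ) ^ 2 * c.M * α₀ ≤ cW := hs.trans ((min_le_right _ _).trans ((min_le_right _ _).trans (min_le_left _ _)))
  have hsC : 7 * d * (L : ℝ) ^ 2 * c.M * α₀ ≤ 1 / (16 * C * B) :=
    hs.trans ((min_le_right _ _).trans ((min_le_right _ _).trans (min_le_right _ _)))
  obtain ⟨⟨hα3, hα2, hsmall⟩, -, -, ⟨-, -, -, -, hc3α, -⟩, h12⟩ := W c.M c.ρ hM1 c.ρ_le_M hM hLdM α₀ hα hsW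
  obtain ⟨u, hu, huS, h129, hLan, h162, hw, h135⟩ := H4 η hη c.k hk c.a c.M c.ρ c.L_le_ρ c.ρ_le_M hM SHFP₀ SHFP SH59 U₀ hU₀ α₀ hα hα3
    hα2 Ω hA c.tcube_sub hsmall (smallness_134 hLpos hα hLdM hs₄)
  obtain ⟨-, h136₂, -, h136₃, h136₄⟩ := H3 η hη c.k hk c.a c.M c.ρ c.L_le_ρ c.ρ_le_M hM hLdM SB9 U₀ hU₀ α₀ hα Ω hA c.tcube_sub hs₃ u hu
    h129 hLan h162
  have h16C : 16 * (131072 * ((d : ℝ) + 1) ^ 2) * (B * ((L : ℝ) ^ 3 * α₀ + 6 * d * (L : ℝ) ^ 2 * c.M * α₀)) ≤ 1 := by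
    have e1 : B * ((L : ℝ) ^ 3 * α₀ + 6 * d * (L : ℝ) ^ 2 * c.M * α₀) ≤ 7 * d * (L : ℝ) ^ 2 * B * c.M * α₀ :=
      const_136 hLpos hα hB0.le hLdM
    have e2 : 7 * d * (L : ℝ) ^ 2 * B * c.M * α₀ = B * (7 * d * (L : ℝ) ^ 2 * c.M * α₀) := by ring
    have e3 : B * (7 * d * (L : ℝ) ^ 2 * c.M * α₀) ≤ B * (1 / (16 * C * B)) := mul_le_mul_of_nonneg_left hsC hB0.le
    have e4 : B * (1 / (16 * C * B)) = 1 / (16 * C) := by field_simp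
    have e5 : B * ((L : ℝ) ^ 3 * α₀ + 6 * d * (L : ℝ) ^ 2 * c.M * α₀) ≤ 1 / (16 * C) := by linarith [e1, e3]
    calc 16 * (131072 * ((d : ℝ) + 1) ^ 2) * (B * ((L : ℝ) ^ 3 * α₀ + 6 * d * (L : ℝ) ^ 2 * c.M * α₀))
        ≤ 16 * C * (1 / (16 * C)) := mul_le_mul_of_nonneg_left e5 (by positivity)
      _ = 1 := by field_simp
  exact gaugedBoundB8_of_clauses hd2 hL hB₀ hη c U₀ hU₀ hα hA hα3 hα2 hsmall h12 h16C hc3α u hu huS h129 hLan h162 hw h135 h136₂ h136₃ h136₄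

/-- **`B8.Prop6Printed d L B₁ c₁` ON `zdCub`, THREE THEOREM-4 SOCKETS + `SockB9P3` AT EVERY CUBE** (`prop6Printed_zdCub` with Theorem 4's existence
half only). [cite: Balaban1985RegularSpaces, Prop. 6 p.99, Thm 4 p.88 (existence)] -/
theorem prop6Printed_zdCub₃ (hd2 : 2 ≤ d) {L : ℕ} (hL : 2 ≤ L) {B₀ B₀' B₀β C₂ cF₀ cF c59 cB9 : ℝ} (hB₀ : 0 < B₀)
    (hB₀' : 0 < B₀') (hB : 2 ≤ 5 * (d : ℝ) * L * B₀) (hB₀β : 0 ≤ B₀β) (hC₂ : 2097152 * ((d : ℝ) + 1) ^ 2 ≤ C₂)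
    (hcF₀ : 0 < cF₀) (hcF : 0 < cF) (hc59 : 0 < c59) (hcB9 : 0 < cB9) (β : ℝ) (len : Site d → ℝ) :
    ∃ c₁ : ℝ, 0 < c₁ ∧ ∀ {ι : Type} (f : ι → ZdIdx d L),
      (∀ (j : ι) (c : CubeB8 d L (f j).k (f j).Ω),
        SockHFP₀ (𝔸 := 𝔸) L B₀ B₀' cF₀ (f j).η c.k (cubeFam false L c.a c.M c.ρ c.k) (cubeLamS L c.a c.M c.ρ c.k) ∧
        SockHFP (𝔸 := 𝔸) L B₀ B₀' cF (f j).η c.k (cubeFam false L c.a c.M c.ρ c.k) (cubeLamS L c.a c.M c.ρ c.k) ∧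
        SockH59 (𝔸 := 𝔸) L B₀ B₀' c59 (f j).η c.k (cubeFam false L c.a c.M c.ρ c.k) (cubeLamS L c.a c.M c.ρ c.k) (cubeLamB L c.a c.M c.ρ c.k) ∧
        SockB9P3 (𝔸 := 𝔸) L B₀ B₀β cB9 β len (f j).η c.k (cubeFam false L c.a c.M c.ρ c.k) (cubeLamS L c.a c.M c.ρ c.k)
          (cubeLamB L c.a c.M c.ρ c.k)) →
      B8.Prop6Printed d (L : ℝ) (5 * (d : ℝ) * L * B₀) c₁ (fun j => zdCub 𝔸 L (f j)) := by
  obtain ⟨c₁, hc₁, G⟩ := gaugedBoundB8_cubeMember₃ (𝔸 := 𝔸) hd2 hL hB₀ hB₀' hB hB₀β hC₂ hcF₀ hcF hc59 hcB9 β len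
  refine ⟨c₁, hc₁, fun f S => ?_⟩
  rw [prop6Printed_zdCub_iff]
  intro j α₀ hα U₀ hInA c hs
  obtain ⟨S₁, S₂, S₃, S₅⟩ := S j c
  exact G (f j).η (f j).hη c S₁ S₂ S₃ S₅ U₀.1 U₀.2 α₀ hα hInA hs

/-! ## §4 (v1.2) The sentence on NODE 00's member of record `cubB8OfRecord θ` -/

/-- **`B8.Prop6Printed` ON THE MEMBER OF RECORD `Node00.cubB8OfRecord θ`** (the `p6` letter of `Node00.b8LeafOfRecord_of_knit` at the located layer
`ResidB8.withCub`, `Node00.prop6Printed_withCub_iff`), for the Stage-3 parameters of record `θ` with `θ.D ≥ 2`, `B₁ := 5·θ.D·θ.L·B₀` and the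
threshold of `gaugedBoundB8_cubeMember₃` — MODULO the three Theorem-4 existence sockets and the Prop.-3-frame b9 socket at every cube of every
member of record (`prop6Printed_zdCub₃` at `f := Subtype.val`). [cite: Balaban1985RegularSpaces, Prop. 6 p.99] -/
theorem prop6Printed_cubB8OfRecord₃ (θ : Node00.Stage3Params) (hD : 2 ≤ θ.D) {B₀ B₀' B₀β C₂ cF₀ cF c59 cB9 : ℝ} (hB₀ : 0 < B₀)
    (hB₀' : 0 < B₀') (hB : 2 ≤ 5 * (θ.D : ℝ) * θ.L * B₀) (hB₀β : 0 ≤ B₀β) (hC₂ : 2097152 * ((θ.D : ℝ) + 1) ^ 2 ≤ C₂)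
    (hcF₀ : 0 < cF₀) (hcF : 0 < cF) (hc59 : 0 < c59) (hcB9 : 0 < cB9) (β : ℝ) (len : Site θ.D → ℝ) :
    ∃ c₁ : ℝ, 0 < c₁ ∧
      ((∀ (i : Node00.IdxB8 θ) (c : CubeB8 θ.D θ.L i.1.k i.1.Ω),
        SockHFP₀ (𝔸 := θ.𝔸) θ.L B₀ B₀' cF₀ i.1.η c.k (cubeFam false θ.L c.a c.M c.ρ c.k) (cubeLamS θ.L c.a c.M c.ρ c.k) ∧
        SockHFP (𝔸 := θ.𝔸) θ.L B₀ B₀' cF i.1.η c.k (cubeFam false θ.L c.a c.M c.ρ c.k) (cubeLamS θ.L c.a c.M c.ρ c.k) ∧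
        SockH59 (𝔸 := θ.𝔸) θ.L B₀ B₀' c59 i.1.η c.k (cubeFam false θ.L c.a c.M c.ρ c.k) (cubeLamS θ.L c.a c.M c.ρ c.k)
          (cubeLamB θ.L c.a c.M c.ρ c.k) ∧
        SockB9P3 (𝔸 := θ.𝔸) θ.L B₀ B₀β cB9 β len i.1.η c.k (cubeFam false θ.L c.a c.M c.ρ c.k) (cubeLamS θ.L c.a c.M c.ρ c.k)
          (cubeLamB θ.L c.a c.M c.ρ c.k)) →
      B8.Prop6Printed θ.D (θ.L : ℝ) (5 * (θ.D : ℝ) * θ.L * B₀) c₁ (Node00.cubB8OfRecord θ)) := by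
  obtain ⟨c₁, hc₁, G⟩ := prop6Printed_zdCub₃ (𝔸 := θ.𝔸) hD θ.two_le_L hB₀ hB₀' hB hB₀β hC₂ hcF₀ hcF hc59 hcB9 β len
  exact ⟨c₁, hc₁, fun S => G (fun i : Node00.IdxB8 θ => i.1) S⟩

/-! ## §5 (v1.3) (1.137)'s inequalities at every cube, socket-free -/
/-- **(1.137), THE INEQUALITIES, AT EVERY CUBE — SOCKET-FREE** (p. 99: «|(1∕i) log Ū₀′ᵏ(x, x′)| < |x − y|4α₀ ≤ 2dMα₀ for ⟨x, x′⟩ ⊂ □^{(k)}, y is a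
center of □»; and `Ū₀″ᵏ = Ū₀′ᵏ` there): ONE threshold `c₁(d, L) > 0`; for every cube `c : CubeB8 d L K Ω`, unitary `U₀ ∈ 𝔄_K({Ω_j}, α₀)`, «`7dL²·c.M·α₀
≤ c₁`», and bond `⟨x, x + e_μ⟩ ⊂ □^{(k)}` (`U₀′ = c.axial U₀`, `U₀″ = c.dprime U₀`, `y = ctr c.a c.M`) — `B8Prop6OfThm4.ineq137_cube` BY NAME, the
(1.130)-regime and `dMα₀ ≤ 1∕2` from `windows136_of_small`.
[cite: Balaban1985RegularSpaces, Prop. 6 (1.137) p.99, (1.128)–(1.129) p.98; Balaban1985Averaging, Prop. 2 p.26] -/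
theorem ineq137_cubeB8 (hd2 : 2 ≤ d) {L : ℕ} (hL : 2 ≤ L) :
    ∃ c₁ : ℝ, 0 < c₁ ∧ ∀ {η : ℝ} {K : ℕ} {Ω : ℕ → Set (Site d)} (c : CubeB8 d L K Ω)
      (U₀ : Site d → Fin d → 𝔸ˣ), (∀ x κ, U₀ x κ ∈ unitaryUnits 𝔸) → ∀ (α₀ : ℝ), 0 < α₀ → InAk L K η α₀ Ω U₀ →
      7 * d * (L : ℝ) ^ 2 * c.M * α₀ ≤ c₁ →
      ∀ (x : Site d) (μ : Fin d), B8Eq131Cubes.bLo L c.a 0 0 ≤ x → x + e μ ≤ B8Eq131Cubes.bHi L c.a c.M 0 0 →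
        avgIter L (c.dprime U₀) c.k x μ = avgIter L (c.axial U₀) c.k x μ ∧
        ‖(Complex.I⁻¹ : ℂ) • mlog ((avgIter L (c.axial U₀) c.k x μ : 𝔸ˣ) : 𝔸)‖ ≤ B7Prop1Explicit.l1 (x - ctr c.a c.M) * (4 * α₀) ∧
        (B7Prop1Explicit.l1 (x - ctr c.a c.M) : ℝ) * (4 * α₀) ≤ 2 * d * c.M * α₀ := by
  obtain ⟨cW, hcW, W⟩ := windows136_of_small hd2 hL one_pos le_rfl one_pos
  refine ⟨cW, hcW, fun c U₀ hU₀ α₀ hα hAK hs x μ hx hx' => ?_⟩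
  have hM1 : 1 ≤ c.M := ((le_trans (by norm_num) hL : 1 ≤ L).trans c.L_le_ρ).trans c.ρ_le_M
  obtain ⟨⟨hα3, hα2, -⟩, -, -, -, h12⟩ := W c.M c.ρ hM1 c.ρ_le_M (by exact_mod_cast c.big) (by exact_mod_cast c.L_le_dM) α₀ hα hs
  exact B8Prop6OfThm4.ineq137_cube L hL (avgClosed_unitaryUnits d L) c.k U₀ hU₀ hα hα3 hα2 c.a c.ρ hM1 (c.inAk hAK) c.tcube_sub c.box_sub
    h12 x μ hx hx'

end Literature.MathematicalPhysics.QuantumFieldTheory.Balaban1983to89.B8Prop6CubeMemberGauged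

end
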